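import Summits.Ventures.LatticeQCDFlow.Exactness.IMHTauIntParityDefectWeightBound
import HarnessLib

/-!
# The `τ_int` column, SYMMETRIC: two weight-bounded flow samplers under a density parity off `E`
# have `|τ − τ'| ≤ (e^δ − 1)(min(τ, τ') + ½) + 4e^{−δ} B² max(C, C')² Z⁻² ∫_E w / ∫ g² w`

HONEST FRAMING: exact (Metropolis-corrected) sampling algorithms for lattice gauge theory;
figures of merit are autocorrelation/cost numbers at stated couplings and volumes; no
continuum-physics claim.

Venture `LatticeQCDFlow` (cell pub-lqcd), topic `Exactness`; FANOUT row 4 (`s0-u1-b`, rung S0-B: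
two independent codes A, B for the 2D U(1) flow sampler, compared by the clause '`τ_int(Q)` A vs B').
Sequel of `IMHTauIntParityDefectWeightBound.lean` (same row), which proved the ONE-SIDED window-free
law: parity `|log q − log q'| ≤ δ` off a set `E`, a weight ceiling `w ≤ C'·q'` for the OTHER model
and summable autocovariances under `K = imhOp μ w q` give
`τ' + ½ ≤ e^{δ}(τ + ½) + e^{−δ}·4(B C'/Z)²·min(∫_E w, Z∫_E q)/∫ g² w`.  Its docstring lists the
reverse inequality as NOT CLAIMED.  This file closes that: the parity hypothesis is symmetric in
`q, q'`, and a weight ceiling on a model makes ITS OWN autocovariance series summable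
(`summable_autocov_of_weightBound`, the geometric decay `abs_autocov_le` of
`FlowSamplerAutocorrelation.lean`, packaged), so when BOTH codes carry a weight ceiling — the cell's
standing hypothesis `W = sup w/(Z q) < ∞` for each arm (`FlowSamplerSpectralGap`,
`FlowSamplerAutocorrelation`) — no summability hypothesis is left and the law holds both ways round.
NEW WORK of the cell; nothing is cited as a fact; no definition is introduced.

## What is proved (`(X, μ)` s-finite; `w > 0` measurable integrable, `Z = ∫ w`; `q, q' > 0`
measurable, `∫ q = ∫ q' = 1`; `w ≤ C q`, `w ≤ C' q'`; `K = imhOp μ w q`, `K' = imhOp μ w q'`;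
`g` measurable, `|g| ≤ B`, `∫ g w = 0`; `A = ∫ g² w`, `S = A + Σ_{k≥0} ∫ g (K^{k+1} g) w`,
`S'` likewise; `τ = tauInt (k ↦ C(k)/A)`, `τ'` likewise, so that `τ + ½ = S/A`)

* §0 **`summable_autocov_of_weightBound`** — `w ≤ C q`, `g` centred bounded ⇒
  `Σ_k ∫ g (K^{k+1} g) w` is (absolutely) summable; `greenKubo_le_mul_of_weightBound` —
  `S ≤ A·C/Z` (the tree's `τ_int ≤ W − ½` in Green–Kubo form).
* §1 **`greenKubo_le_and_le_of_logParityOff_of_weightBounds`** — parity off `E` + both ceilings: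
  `S' ≤ e^{δ} S + e^{−δ}·4(B C'/Z)²·min(∫_E w, Z∫_E q)` AND
  `S ≤ e^{δ} S' + e^{−δ}·4(B C/Z)²·min(∫_E w, Z∫_E q')`;
  **`tauInt_le_and_le_of_logParityOff_of_weightBounds`** — the same on `Scoring.tauInt` (`A > 0`).
* §2 **`abs_tauInt_sub_le_of_logParityOff_of_weightBounds`** — the SYMMETRIC law
  `|τ − τ'| ≤ (e^{δ} − 1)(min(τ, τ') + ½) + e^{−δ}·4(B·max(C, C')/Z)²·(∫_E w)/A`;
  `abs_greenKubo_sub_le_of_logParityOff_of_weightBounds` — its Green–Kubo form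
  `|S − S'| ≤ (e^{δ} − 1)·min(S, S') + e^{−δ}·4(B·max(C, C')/Z)²·∫_E w`;
  **`abs_tauInt_sub_div_le_of_logParityOff_of_weightBounds`** — the RELATIVE form
  `|τ − τ'|/(min(τ, τ') + ½) ≤ (e^{δ} − 1) + e^{−δ}·4(B·max(C, C')/Z)²·(∫_E w)/A`
  (uses `τ, τ' ≥ ½`: the flow sampler's autocovariances are nonnegative, `autocov_nonneg`).

Reading for row 4 (value-free; no number of ours, no sealed value).  In normalised units
(`π = w/Z`, `W = C/Z`, `W' = C'/Z`, `E_π g² = A/Z`, `π(E) = ∫_E w/Z`) the symmetric law reads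
`|τ_A − τ_B| ≤ (e^{δ} − 1)(min(τ_A, τ_B) + ½) + 4e^{−δ}·max(W_A, W_B)²·(B²/E_π g²)·π(E)`: once
each arm certifies its own weight ceiling, a density parity `δ` between the two codes that fails on
a set `E` of target mass `π(E)` pins the two integrated autocorrelation times of EVERY bounded
observable to each other — relative discrepancy of `τ + ½` at most `e^{δ} − 1` plus
`4e^{−δ} max(W_A, W_B)² (B²/E_π g²) π(E)` — with hypotheses and conclusion symmetric under
`A ↔ B`.  The exceptional set enters through its TARGET mass times the square of the larger weight
level (the finer masses `min(π(E), q_B(E))`, `min(π(E), q_A(E))` of §1 are kept there).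
NOT CLAIMED: sharpness of `4` or of the square (`IMHTauIntParityDefectWeightBound`: the two-point
witness has truth `∝ W'`, bound `∝ W'²`); anything without weight ceilings beyond the window law of
`IMHTauIntParityDefect`; any statistical statement (estimating `π(E)`, `W`, `δ` from finitely
many draws); HMC / local Metropolis; unbounded observables; any number re-scored.
-/

namespace Summit.Ventures.LatticeQCDFlow.Exactness

open Real MeasureTheory Filter Set Topology
open Summit.Ventures.LatticeQCDFlow.Scoring

variable {X : Type*} [MeasurableSpace X] {μ : Measure X} {w q : X → ℝ}

variable [SFinite μ]

/-! ## §0 A weight ceiling makes the autocovariance series summable -/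

/-- **Summability under a weight ceiling.**  `w ≤ C·q` pointwise, `∫ q = 1`; `g` bounded measurable
and centred (`∫ g w = 0`).  Then the lag-`(k+1)` autocovariances `∫ g (K^{k+1} g) w` of the exact
flow sampler form an (absolutely) summable series — they are dominated by the geometric sequence
`(1 − Z/C)^{k+1} ∫ g² w` (`abs_autocov_le`). [folklore] -/
theorem summable_autocov_of_weightBound (hw0 : ∀ t, 0 < w t) (hwm : Measurable w)
    (hwi : Integrable w μ) (hq0 : ∀ t, 0 < q t) (hqm : Measurable q) (hqi : Integrable q μ)
    (hq1 : ∫ t, q t ∂μ = 1) {C : ℝ} (hC : ∀ t, w t ≤ C * q t) {g : X → ℝ} (hgm : Measurable g)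
    {B : ℝ} (hgb : ∀ t, |g t| ≤ B) (hg0 : ∫ t, g t * w t ∂μ = 0) :
    Summable fun k => ∫ t, g t * ((imhOp μ w q)^[k + 1] g) t * w t ∂μ := by
  obtain ⟨-, -, hr0, hr1⟩ := rate_bounds hw0 hwi hq0 hqi hq1 hC
  have hrabs : |1 - (∫ s, w s ∂μ) / C| < 1 := by rw [abs_of_nonneg hr0]; exact hr1
  refine Summable.of_norm_bounded
    (((hasSum_geometric_succ hrabs).summable).mul_left (∫ t, g t ^ 2 * w t ∂μ)) fun k => ?_
  rw [Real.norm_eq_abs, mul_comm]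
  exact abs_autocov_le hw0 hwm hwi hq0 hqm hqi hq1 hC hgm hgb hg0 (k + 1)

/-- **The Green–Kubo sum under a weight ceiling**: `w ≤ C·q`, `g` centred bounded ⇒
`∫ g² w + Σ_{k≥0} ∫ g (K^{k+1} g) w ≤ (∫ g² w)·C/Z` — the tree's `τ_int ≤ C/Z − ½`
(`tauInt_autocorr_le`) before dividing by `∫ g² w` (so also valid when `∫ g² w = 0`). [folklore] -/
theorem greenKubo_le_mul_of_weightBound (hw0 : ∀ t, 0 < w t) (hwm : Measurable w)
    (hwi : Integrable w μ) (hq0 : ∀ t, 0 < q t) (hqm : Measurable q) (hqi : Integrable q μ)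
    (hq1 : ∫ t, q t ∂μ = 1) {C : ℝ} (hC : ∀ t, w t ≤ C * q t) {g : X → ℝ} (hgm : Measurable g)
    {B : ℝ} (hgb : ∀ t, |g t| ≤ B) (hg0 : ∫ t, g t * w t ∂μ = 0) :
    (∫ t, g t ^ 2 * w t ∂μ) + ∑' k, ∫ t, g t * ((imhOp μ w q)^[k + 1] g) t * w t ∂μ
      ≤ (∫ t, g t ^ 2 * w t ∂μ) * (C / ∫ s, w s ∂μ) := by
  obtain ⟨hZ, hCpos, hr0, hr1⟩ := rate_bounds hw0 hwi hq0 hqi hq1 hC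
  set r : ℝ := 1 - (∫ s, w s ∂μ) / C with hr
  set A : ℝ := ∫ t, g t ^ 2 * w t ∂μ with hA
  have hrabs : |r| < 1 := by rw [abs_of_nonneg hr0]; exact hr1
  have hgeo := hasSum_geometric_succ hrabs
  have hs := summable_autocov_of_weightBound hw0 hwm hwi hq0 hqm hqi hq1 hC hgm hgb hg0
  have hle : ∑' k, ∫ t, g t * ((imhOp μ w q)^[k + 1] g) t * w t ∂μ ≤ ∑' k, A * r ^ (k + 1) :=
    hs.tsum_le_tsum (fun k => (le_abs_self _).trans (by
      rw [mul_comm]; exact abs_autocov_le hw0 hwm hwi hq0 hqm hqi hq1 hC hgm hgb hg0 (k + 1)))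
      (hgeo.summable.mul_left A)
  rw [(hgeo.mul_left A).tsum_eq] at hle
  have e : A + A * (r / (1 - r)) = A * (C / ∫ s, w s ∂μ) := by
    have h1r : 1 - r = (∫ s, w s ∂μ) / C := by rw [hr]; ring
    rw [h1r, hr]
    field_simp
    ring
  linarith

/-! ## §1 Both ways round: parity off `E` and a weight ceiling on EACH model -/

/-- **THE GREEN–KUBO COMPARISON, BOTH WAYS ROUND.**  Parity `|log q − log q'| ≤ δ` off a
measurable `E`; weight ceilings `w ≤ C·q` AND `w ≤ C'·q'`; `g` centred bounded measurable.  Then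
(with `S = ∫ g² w + Σ_{k≥0} ∫ g (K^{k+1} g) w`, `S'` likewise, `Z = ∫ w`)
`S' ≤ e^{δ} S + e^{−δ}·4(B C'/Z)²·min(∫_E w, Z∫_E q)` and
`S ≤ e^{δ} S' + e^{−δ}·4(B C/Z)²·min(∫_E w, Z∫_E q')`
(`greenKubo_le_of_logParityOff_of_weightBound` twice; each chain's summability from its own
ceiling, §0; the parity hypothesis is symmetric). -/
theorem greenKubo_le_and_le_of_logParityOff_of_weightBounds {q' : X → ℝ} (hw0 : ∀ t, 0 < w t)
    (hwm : Measurable w) (hwi : Integrable w μ) (hq0 : ∀ t, 0 < q t) (hqm : Measurable q)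
    (hqi : Integrable q μ) (hq1 : ∫ z, q z ∂μ = 1) (hq0' : ∀ t, 0 < q' t) (hqm' : Measurable q')
    (hqi' : Integrable q' μ) (hq1' : ∫ z, q' z ∂μ = 1) {C C' : ℝ} (hC : ∀ t, w t ≤ C * q t)
    (hC' : ∀ t, w t ≤ C' * q' t) {E : Set X} (hE : MeasurableSet E) {δ : ℝ}
    (hlog : ∀ t, t ∉ E → |Real.log (q t) - Real.log (q' t)| ≤ δ) {g : X → ℝ} (hgm : Measurable g)
    {B : ℝ} (hgb : ∀ t, |g t| ≤ B) (hg0 : ∫ t, g t * w t ∂μ = 0) :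
    ((∫ t, g t ^ 2 * w t ∂μ) + ∑' k, ∫ t, g t * ((imhOp μ w q')^[k + 1] g) t * w t ∂μ
        ≤ Real.exp δ * ((∫ t, g t ^ 2 * w t ∂μ)
              + ∑' k, ∫ t, g t * ((imhOp μ w q)^[k + 1] g) t * w t ∂μ)
          + Real.exp (-δ) * (4 * (B * (C' / ∫ s, w s ∂μ)) ^ 2
              * min (∫ t in E, w t ∂μ) ((∫ t, w t ∂μ) * ∫ t in E, q t ∂μ)))
    ∧ ((∫ t, g t ^ 2 * w t ∂μ) + ∑' k, ∫ t, g t * ((imhOp μ w q)^[k + 1] g) t * w t ∂μ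
        ≤ Real.exp δ * ((∫ t, g t ^ 2 * w t ∂μ)
              + ∑' k, ∫ t, g t * ((imhOp μ w q')^[k + 1] g) t * w t ∂μ)
          + Real.exp (-δ) * (4 * (B * (C / ∫ s, w s ∂μ)) ^ 2
              * min (∫ t in E, w t ∂μ) ((∫ t, w t ∂μ) * ∫ t in E, q' t ∂μ))) := by
  have hlog' : ∀ t, t ∉ E → |Real.log (q' t) - Real.log (q t)| ≤ δ := fun t ht => by
    rw [abs_sub_comm]; exact hlog t ht
  exact ⟨(greenKubo_le_of_logParityOff_of_weightBound hw0 hwm hwi hq0 hqm hqi hq1 hq0' hqm' hqi'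
      hq1' hC' hE hlog hgm hgb hg0
      (summable_autocov_of_weightBound hw0 hwm hwi hq0 hqm hqi hq1 hC hgm hgb hg0)).2,
    (greenKubo_le_of_logParityOff_of_weightBound hw0 hwm hwi hq0' hqm' hqi' hq1' hq0 hqm hqi
      hq1 hC hE hlog' hgm hgb hg0
      (summable_autocov_of_weightBound hw0 hwm hwi hq0' hqm' hqi' hq1' hC' hgm hgb hg0)).2⟩

/-- **`τ_int`, BOTH WAYS ROUND** (on `Scoring.tauInt`, `∫ g² w > 0`; `ρ(k) = C(k)/∫ g² w`):
`τ' + ½ ≤ e^{δ}(τ + ½) + e^{−δ}·4(B C'/Z)²·min(∫_E w, Z∫_E q)/∫ g² w` and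
`τ + ½ ≤ e^{δ}(τ' + ½) + e^{−δ}·4(B C/Z)²·min(∫_E w, Z∫_E q')/∫ g² w`. -/
theorem tauInt_le_and_le_of_logParityOff_of_weightBounds {q' : X → ℝ} (hw0 : ∀ t, 0 < w t)
    (hwm : Measurable w) (hwi : Integrable w μ) (hq0 : ∀ t, 0 < q t) (hqm : Measurable q)
    (hqi : Integrable q μ) (hq1 : ∫ z, q z ∂μ = 1) (hq0' : ∀ t, 0 < q' t) (hqm' : Measurable q')
    (hqi' : Integrable q' μ) (hq1' : ∫ z, q' z ∂μ = 1) {C C' : ℝ} (hC : ∀ t, w t ≤ C * q t)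
    (hC' : ∀ t, w t ≤ C' * q' t) {E : Set X} (hE : MeasurableSet E) {δ : ℝ}
    (hlog : ∀ t, t ∉ E → |Real.log (q t) - Real.log (q' t)| ≤ δ) {g : X → ℝ} (hgm : Measurable g)
    {B : ℝ} (hgb : ∀ t, |g t| ≤ B) (hg0 : ∫ t, g t * w t ∂μ = 0)
    (hA : 0 < ∫ t, g t ^ 2 * w t ∂μ) :
    (tauInt (fun k => (∫ t, g t * ((imhOp μ w q')^[k] g) t * w t ∂μ) / ∫ t, g t ^ 2 * w t ∂μ)
          + 1 / 2
        ≤ Real.exp δ * (tauInt (fun k => (∫ t, g t * ((imhOp μ w q)^[k] g) t * w t ∂μ)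
              / ∫ t, g t ^ 2 * w t ∂μ) + 1 / 2)
          + Real.exp (-δ) * (4 * (B * (C' / ∫ s, w s ∂μ)) ^ 2
              * min (∫ t in E, w t ∂μ) ((∫ t, w t ∂μ) * ∫ t in E, q t ∂μ))
            / ∫ t, g t ^ 2 * w t ∂μ)
    ∧ (tauInt (fun k => (∫ t, g t * ((imhOp μ w q)^[k] g) t * w t ∂μ) / ∫ t, g t ^ 2 * w t ∂μ)
          + 1 / 2
        ≤ Real.exp δ * (tauInt (fun k => (∫ t, g t * ((imhOp μ w q')^[k] g) t * w t ∂μ)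
              / ∫ t, g t ^ 2 * w t ∂μ) + 1 / 2)
          + Real.exp (-δ) * (4 * (B * (C / ∫ s, w s ∂μ)) ^ 2
              * min (∫ t in E, w t ∂μ) ((∫ t, w t ∂μ) * ∫ t in E, q' t ∂μ))
            / ∫ t, g t ^ 2 * w t ∂μ) := by
  have hlog' : ∀ t, t ∉ E → |Real.log (q' t) - Real.log (q t)| ≤ δ := fun t ht => by
    rw [abs_sub_comm]; exact hlog t ht
  exact ⟨imhOp_tauInt_le_of_logParityOff_of_weightBound hw0 hwm hwi hq0 hqm hqi hq1 hq0' hqm'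
      hqi' hq1' hC' hE hlog hgm hgb hg0
      (summable_autocov_of_weightBound hw0 hwm hwi hq0 hqm hqi hq1 hC hgm hgb hg0) hA,
    imhOp_tauInt_le_of_logParityOff_of_weightBound hw0 hwm hwi hq0' hqm' hqi' hq1' hq0 hqm hqi
      hq1 hC hE hlog' hgm hgb hg0
      (summable_autocov_of_weightBound hw0 hwm hwi hq0' hqm' hqi' hq1' hC' hgm hgb hg0) hA⟩

/-! ## §2 The symmetric law -/

/-- The two defects of §1 under one roof: for `0 < C₁ ≤ M`, `0 ≤ B`, `0 < Z` and `0 ≤ m ≤ m̄`,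
`e^{−δ}·4(B C₁/Z)²·m ≤ e^{−δ}·4(B M/Z)²·m̄`. -/
theorem parityDefect_mono {δ B C₁ M Z m mbar : ℝ} (hB : 0 ≤ B) (hC₁ : 0 < C₁) (hCM : C₁ ≤ M)
    (hZ : 0 < Z) (hm : 0 ≤ m) (hmm : m ≤ mbar) :
    Real.exp (-δ) * (4 * (B * (C₁ / Z)) ^ 2 * m)
      ≤ Real.exp (-δ) * (4 * (B * (M / Z)) ^ 2 * mbar) := by
  refine mul_le_mul_of_nonneg_left ?_ (Real.exp_pos _).le
  have h1 : 0 ≤ B * (C₁ / Z) := mul_nonneg hB (div_nonneg hC₁.le hZ.le)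
  have h2 : B * (C₁ / Z) ≤ B * (M / Z) :=
    mul_le_mul_of_nonneg_left (div_le_div_of_nonneg_right hCM hZ.le) hB
  have h3 : (B * (C₁ / Z)) ^ 2 ≤ (B * (M / Z)) ^ 2 := pow_le_pow_left₀ h1 h2 2
  calc 4 * (B * (C₁ / Z)) ^ 2 * m ≤ 4 * (B * (M / Z)) ^ 2 * m :=
        mul_le_mul_of_nonneg_right (by linarith) hm
    _ ≤ 4 * (B * (M / Z)) ^ 2 * mbar := mul_le_mul_of_nonneg_left hmm (by positivity)

/-- **THE SYMMETRIC GREEN–KUBO LAW.**  Under the hypotheses of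
`greenKubo_le_and_le_of_logParityOff_of_weightBounds`:
`|S − S'| ≤ (e^{δ} − 1)·min(S, S') + e^{−δ}·4(B·max(C, C')/Z)²·∫_E w`. -/
theorem abs_greenKubo_sub_le_of_logParityOff_of_weightBounds {q' : X → ℝ} (hw0 : ∀ t, 0 < w t)
    (hwm : Measurable w) (hwi : Integrable w μ) (hq0 : ∀ t, 0 < q t) (hqm : Measurable q)
    (hqi : Integrable q μ) (hq1 : ∫ z, q z ∂μ = 1) (hq0' : ∀ t, 0 < q' t) (hqm' : Measurable q')
    (hqi' : Integrable q' μ) (hq1' : ∫ z, q' z ∂μ = 1) {C C' : ℝ} (hC : ∀ t, w t ≤ C * q t)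
    (hC' : ∀ t, w t ≤ C' * q' t) {E : Set X} (hE : MeasurableSet E) {δ : ℝ}
    (hlog : ∀ t, t ∉ E → |Real.log (q t) - Real.log (q' t)| ≤ δ) {g : X → ℝ} (hgm : Measurable g)
    {B : ℝ} (hgb : ∀ t, |g t| ≤ B) (hg0 : ∫ t, g t * w t ∂μ = 0) :
    |((∫ t, g t ^ 2 * w t ∂μ) + ∑' k, ∫ t, g t * ((imhOp μ w q)^[k + 1] g) t * w t ∂μ)
        - ((∫ t, g t ^ 2 * w t ∂μ) + ∑' k, ∫ t, g t * ((imhOp μ w q')^[k + 1] g) t * w t ∂μ)|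
      ≤ (Real.exp δ - 1)
          * min ((∫ t, g t ^ 2 * w t ∂μ) + ∑' k, ∫ t, g t * ((imhOp μ w q)^[k + 1] g) t * w t ∂μ)
              ((∫ t, g t ^ 2 * w t ∂μ) + ∑' k, ∫ t, g t * ((imhOp μ w q')^[k + 1] g) t * w t ∂μ)
        + Real.exp (-δ) * (4 * (B * (max C C' / ∫ s, w s ∂μ)) ^ 2 * ∫ t in E, w t ∂μ) := by
  obtain ⟨h1, h2⟩ := greenKubo_le_and_le_of_logParityOff_of_weightBounds hw0 hwm hwi hq0 hqm hqi
    hq1 hq0' hqm' hqi' hq1' hC hC' hE hlog hgm hgb hg0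
  obtain ⟨hZ, hCpos, -, -⟩ := rate_bounds hw0 hwi hq0 hqi hq1 hC
  obtain ⟨-, hCpos', -, -⟩ := rate_bounds hw0 hwi hq0' hqi' hq1' hC'
  set S : ℝ := (∫ t, g t ^ 2 * w t ∂μ) + ∑' k, ∫ t, g t * ((imhOp μ w q)^[k + 1] g) t * w t ∂μ
  set S' : ℝ := (∫ t, g t ^ 2 * w t ∂μ) + ∑' k, ∫ t, g t * ((imhOp μ w q')^[k + 1] g) t * w t ∂μ
  have hB : 0 ≤ B := by
    rcases isEmpty_or_nonempty X with hX | ⟨⟨t⟩⟩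
    · exact absurd (Measure.eq_zero_of_isEmpty μ) (by
        intro h; rw [h, integral_zero_measure] at hq1; exact zero_ne_one hq1)
    · exact (abs_nonneg _).trans (hgb t)
  have hmE : 0 ≤ ∫ t in E, w t ∂μ := setIntegral_nonneg hE fun t _ => (hw0 t).le
  have hR' := parityDefect_mono (δ := δ) hB hCpos' (le_max_right C C') hZ
    (le_min hmE (mul_nonneg hZ.le (setIntegral_nonneg hE fun t _ => (hq0 t).le)))
    (min_le_left (∫ t in E, w t ∂μ) ((∫ t, w t ∂μ) * ∫ t in E, q t ∂μ))
  have hR := parityDefect_mono (δ := δ) hB hCpos (le_max_left C C') hZ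
    (le_min hmE (mul_nonneg hZ.le (setIntegral_nonneg hE fun t _ => (hq0' t).le)))
    (min_le_left (∫ t in E, w t ∂μ) ((∫ t, w t ∂μ) * ∫ t in E, q' t ∂μ))
  rcases le_total S S' with h | h
  · rw [min_eq_left h, abs_of_nonpos (sub_nonpos.2 h)]
    linarith
  · rw [min_eq_right h, abs_of_nonneg (sub_nonneg.2 h)]
    linarith

/-- **THE SYMMETRIC `τ_int` LAW.**  `(X, μ)` s-finite; `w > 0` measurable integrable, `Z = ∫ w`;
two models `q, q' > 0` measurable with `∫ q = ∫ q' = 1` and weight ceilings `w ≤ C q`, `w ≤ C' q'`;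
parity `|log q − log q'| ≤ δ` off a measurable `E`; `g` measurable, `|g| ≤ B`, `∫ g w = 0`,
`∫ g² w > 0`; `τ, τ'` the integrated autocorrelation times of `g` under `imhOp μ w q`,
`imhOp μ w q'` (`Scoring.tauInt` of `ρ(k) = ∫ g (Kᵏ g) w/∫ g² w`).  Then
`|τ − τ'| ≤ (e^{δ} − 1)(min(τ, τ') + ½) + e^{−δ}·4(B·max(C, C')/Z)²·(∫_E w)/∫ g² w` —
hypotheses and conclusion symmetric under `q ↔ q'`. -/
theorem abs_tauInt_sub_le_of_logParityOff_of_weightBounds {q' : X → ℝ} (hw0 : ∀ t, 0 < w t)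
    (hwm : Measurable w) (hwi : Integrable w μ) (hq0 : ∀ t, 0 < q t) (hqm : Measurable q)
    (hqi : Integrable q μ) (hq1 : ∫ z, q z ∂μ = 1) (hq0' : ∀ t, 0 < q' t) (hqm' : Measurable q')
    (hqi' : Integrable q' μ) (hq1' : ∫ z, q' z ∂μ = 1) {C C' : ℝ} (hC : ∀ t, w t ≤ C * q t)
    (hC' : ∀ t, w t ≤ C' * q' t) {E : Set X} (hE : MeasurableSet E) {δ : ℝ}
    (hlog : ∀ t, t ∉ E → |Real.log (q t) - Real.log (q' t)| ≤ δ) {g : X → ℝ} (hgm : Measurable g)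
    {B : ℝ} (hgb : ∀ t, |g t| ≤ B) (hg0 : ∫ t, g t * w t ∂μ = 0)
    (hA : 0 < ∫ t, g t ^ 2 * w t ∂μ) :
    |tauInt (fun k => (∫ t, g t * ((imhOp μ w q)^[k] g) t * w t ∂μ) / ∫ t, g t ^ 2 * w t ∂μ)
        - tauInt (fun k => (∫ t, g t * ((imhOp μ w q')^[k] g) t * w t ∂μ) / ∫ t, g t ^ 2 * w t ∂μ)|
      ≤ (Real.exp δ - 1)
          * (min (tauInt (fun k => (∫ t, g t * ((imhOp μ w q)^[k] g) t * w t ∂μ)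
                / ∫ t, g t ^ 2 * w t ∂μ))
              (tauInt (fun k => (∫ t, g t * ((imhOp μ w q')^[k] g) t * w t ∂μ)
                / ∫ t, g t ^ 2 * w t ∂μ)) + 1 / 2)
        + Real.exp (-δ) * (4 * (B * (max C C' / ∫ s, w s ∂μ)) ^ 2 * ∫ t in E, w t ∂μ)
            / ∫ t, g t ^ 2 * w t ∂μ := by
  obtain ⟨h1, h2⟩ := tauInt_le_and_le_of_logParityOff_of_weightBounds hw0 hwm hwi hq0 hqm hqi hq1
    hq0' hqm' hqi' hq1' hC hC' hE hlog hgm hgb hg0 hA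
  obtain ⟨hZ, hCpos, -, -⟩ := rate_bounds hw0 hwi hq0 hqi hq1 hC
  obtain ⟨-, hCpos', -, -⟩ := rate_bounds hw0 hwi hq0' hqi' hq1' hC'
  set τ : ℝ := tauInt (fun k => (∫ t, g t * ((imhOp μ w q)^[k] g) t * w t ∂μ)
    / ∫ t, g t ^ 2 * w t ∂μ)
  set τ' : ℝ := tauInt (fun k => (∫ t, g t * ((imhOp μ w q')^[k] g) t * w t ∂μ)
    / ∫ t, g t ^ 2 * w t ∂μ)
  have hB : 0 ≤ B := by
    rcases isEmpty_or_nonempty X with hX | ⟨⟨t⟩⟩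
    · exact absurd (Measure.eq_zero_of_isEmpty μ) (by
        intro h; rw [h, integral_zero_measure] at hq1; exact zero_ne_one hq1)
    · exact (abs_nonneg _).trans (hgb t)
  have hmE : 0 ≤ ∫ t in E, w t ∂μ := setIntegral_nonneg hE fun t _ => (hw0 t).le
  have hR' := div_le_div_of_nonneg_right (parityDefect_mono (δ := δ) hB hCpos' (le_max_right C C')
    hZ (le_min hmE (mul_nonneg hZ.le (setIntegral_nonneg hE fun t _ => (hq0 t).le)))
    (min_le_left (∫ t in E, w t ∂μ) ((∫ t, w t ∂μ) * ∫ t in E, q t ∂μ))) hA.le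
  have hR := div_le_div_of_nonneg_right (parityDefect_mono (δ := δ) hB hCpos (le_max_left C C')
    hZ (le_min hmE (mul_nonneg hZ.le (setIntegral_nonneg hE fun t _ => (hq0' t).le)))
    (min_le_left (∫ t in E, w t ∂μ) ((∫ t, w t ∂μ) * ∫ t in E, q' t ∂μ))) hA.le
  rcases le_total τ τ' with h | h
  · rw [min_eq_left h, abs_of_nonpos (sub_nonpos.2 h)]
    linarith
  · rw [min_eq_right h, abs_of_nonneg (sub_nonneg.2 h)]
    linarith

/-- `τ_int ≥ ½` for the exact flow sampler under a weight ceiling: every autocovariance is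
nonnegative (`autocov_nonneg`) and the series is summable (§0). -/
theorem half_le_tauInt_of_weightBound (hw0 : ∀ t, 0 < w t) (hwm : Measurable w)
    (hwi : Integrable w μ) (hq0 : ∀ t, 0 < q t) (hqm : Measurable q) (hqi : Integrable q μ)
    (hq1 : ∫ t, q t ∂μ = 1) {g : X → ℝ} (hgm : Measurable g) {B : ℝ} (hgb : ∀ t, |g t| ≤ B) :
    1 / 2 ≤ tauInt (fun k => (∫ t, g t * ((imhOp μ w q)^[k] g) t * w t ∂μ)
      / ∫ t, g t ^ 2 * w t ∂μ) := by
  simp only [tauInt]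
  have h : 0 ≤ ∑' k, (∫ t, g t * ((imhOp μ w q)^[k + 1] g) t * w t ∂μ) / ∫ t, g t ^ 2 * w t ∂μ :=
    tsum_nonneg fun k => div_nonneg (autocov_nonneg hw0 hwm hwi hq0 hqm hqi hq1 hgm hgb (k + 1))
      (integral_nonneg fun t => mul_nonneg (sq_nonneg _) (hw0 t).le)
  linarith

/-- **THE RELATIVE FORM.**  Under the hypotheses of
`abs_tauInt_sub_le_of_logParityOff_of_weightBounds`:
`|τ − τ'|/(min(τ, τ') + ½) ≤ (e^{δ} − 1) + e^{−δ}·4(B·max(C, C')/Z)²·(∫_E w)/∫ g² w`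
(divide the symmetric law by `min(τ, τ') + ½ ≥ 1`, `half_le_tauInt_of_weightBound`). -/
theorem abs_tauInt_sub_div_le_of_logParityOff_of_weightBounds {q' : X → ℝ} (hw0 : ∀ t, 0 < w t)
    (hwm : Measurable w) (hwi : Integrable w μ) (hq0 : ∀ t, 0 < q t) (hqm : Measurable q)
    (hqi : Integrable q μ) (hq1 : ∫ z, q z ∂μ = 1) (hq0' : ∀ t, 0 < q' t) (hqm' : Measurable q')
    (hqi' : Integrable q' μ) (hq1' : ∫ z, q' z ∂μ = 1) {C C' : ℝ} (hC : ∀ t, w t ≤ C * q t)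
    (hC' : ∀ t, w t ≤ C' * q' t) {E : Set X} (hE : MeasurableSet E) {δ : ℝ}
    (hlog : ∀ t, t ∉ E → |Real.log (q t) - Real.log (q' t)| ≤ δ) {g : X → ℝ} (hgm : Measurable g)
    {B : ℝ} (hgb : ∀ t, |g t| ≤ B) (hg0 : ∫ t, g t * w t ∂μ = 0)
    (hA : 0 < ∫ t, g t ^ 2 * w t ∂μ) :
    |tauInt (fun k => (∫ t, g t * ((imhOp μ w q)^[k] g) t * w t ∂μ) / ∫ t, g t ^ 2 * w t ∂μ)
        - tauInt (fun k => (∫ t, g t * ((imhOp μ w q')^[k] g) t * w t ∂μ) / ∫ t, g t ^ 2 * w t ∂μ)|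
        / (min (tauInt (fun k => (∫ t, g t * ((imhOp μ w q)^[k] g) t * w t ∂μ)
                / ∫ t, g t ^ 2 * w t ∂μ))
              (tauInt (fun k => (∫ t, g t * ((imhOp μ w q')^[k] g) t * w t ∂μ)
                / ∫ t, g t ^ 2 * w t ∂μ)) + 1 / 2)
      ≤ (Real.exp δ - 1)
        + Real.exp (-δ) * (4 * (B * (max C C' / ∫ s, w s ∂μ)) ^ 2 * ∫ t in E, w t ∂μ)
            / ∫ t, g t ^ 2 * w t ∂μ := by
  have key := abs_tauInt_sub_le_of_logParityOff_of_weightBounds hw0 hwm hwi hq0 hqm hqi hq1 hq0'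
    hqm' hqi' hq1' hC hC' hE hlog hgm hgb hg0 hA
  have hτ := half_le_tauInt_of_weightBound hw0 hwm hwi hq0 hqm hqi hq1 hgm hgb (q := q)
  have hτ' := half_le_tauInt_of_weightBound hw0 hwm hwi hq0' hqm' hqi' hq1' hgm hgb (q := q')
  set τ : ℝ := tauInt (fun k => (∫ t, g t * ((imhOp μ w q)^[k] g) t * w t ∂μ)
    / ∫ t, g t ^ 2 * w t ∂μ)
  set τ' : ℝ := tauInt (fun k => (∫ t, g t * ((imhOp μ w q')^[k] g) t * w t ∂μ)
    / ∫ t, g t ^ 2 * w t ∂μ)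
  set R : ℝ := Real.exp (-δ) * (4 * (B * (max C C' / ∫ s, w s ∂μ)) ^ 2 * ∫ t in E, w t ∂μ)
    / ∫ t, g t ^ 2 * w t ∂μ
  have hm1 : 1 ≤ min τ τ' + 1 / 2 := by
    have := le_min hτ hτ'
    linarith
  have hm0 : 0 < min τ τ' + 1 / 2 := by linarith
  rw [div_le_iff₀ hm0]
  have hR0 : 0 ≤ R := by
    obtain ⟨hZ, -, -, -⟩ := rate_bounds hw0 hwi hq0 hqi hq1 hC
    exact div_nonneg (mul_nonneg (Real.exp_pos _).le (mul_nonneg (by positivity)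
      (setIntegral_nonneg hE fun t _ => (hw0 t).le))) hA.le
  calc |τ - τ'| ≤ (Real.exp δ - 1) * (min τ τ' + 1 / 2) + R := key
    _ ≤ (Real.exp δ - 1) * (min τ τ' + 1 / 2) + R * (min τ τ' + 1 / 2) := by
        have := le_mul_of_one_le_right hR0 hm1
        linarith
    _ = (Real.exp δ - 1 + R) * (min τ τ' + 1 / 2) := by ring

end Summit.Ventures.LatticeQCDFlow.Exactness
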